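import Summits.CriticalPhenomena.PercolationContinuityZ3.Theorems.PercLowPointHalfSpaceTallClusterMassBoundArrowOneThreshold
import Summits.CriticalPhenomena.PercolationContinuityZ3.Theorems.PercLowPointHalfSpaceTallClusterMassBoundWallArmPartial
import Summits.CriticalPhenomena.PercolationContinuityZ3.Theorems.PercLowPointHalfSpaceLowPointBookkeepingSharpReduce

/-!
# `TallClusterMassBound` (stmt-CriticalPhenomena-0912), line `onesided-halves` — forms of stub G (`stub_typicalMaxPolyGrowth`)

Stub G of the skeleton `Cruxes/TallClusterMassBound/Lines/onesided_halves.lean` is the polynomial LOWER growth of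
Hutchcroft's typical maximum `M(Λ) = typicalMax μ Λ = min{n | μ(|K_max(Λ)| ≥ n) ≤ e^{-1}}` of the largest cluster
trace, for bond percolation on the induced half-space `P^ℍ = floorDilutedPercolation 3 p_c 1` at `p_c(ℤ³)` in the
half-boxes `Λ_r = halfBox r = B_r ∩ ℍ`:

  `G : ∃ c κ > 0, ∀ 1 ≤ ρ ≤ r, c (r/ρ)^κ M(Λ_ρ) ≤ M(Λ_r)`.

This file lands, sorry-free, the closed structural facts around G (no criticality is used; everything below holds
for an arbitrary measure / every edge density):

* §1 monotonicity in the region (registered helper `typicalMax_mono_of_subset`): `Λ ⊆ Λ'` gives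
  `M(Λ) ≤ M(Λ')` for EVERY measure (if `μ` is infinite then `M(Λ) = 0`), from `|K_max(Λ)| ≤ |K_max(Λ')|`
  (`FloorRusso.Reduce.clusterMaxIn_mono_set`, already in the tree); `halfBox_mono`, `typicalMax_halfBox_mono`.
* §2 the quantile unfolded: `n < M(Λ) ↔ e^{-1} < μ(|K_max(Λ)| ≥ n)` (finite `μ`), so that
  `2 M(Λ_r) ≤ M(Λ_{Lr}) ↔ e^{-1} < P^ℍ(|K_max(Λ_{Lr})| ≥ 2 M(Λ_r) - 1)` (`two_mul_typicalMax_le_iff`) — the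
  missing MERGING estimate of the line in probabilistic form.
* §3 the RESHAPE (registered helper `typicalMaxPolyGrowth_iff_fixedRatio`):
  `G ↔ ∃ L ≥ 2, ∀ r ≥ 1, 2 M(Λ_r) ≤ M(Λ_{Lr})` — fixed-ratio doubling of the typical maximum. `→`: `ρ = r`,
  `r ↦ L r` with `c L^κ > 2`; `←`: iterate along the powers of `L` (`typicalMax_pow_mul_ge`), use §1 for the last
  partial step, `κ = log_L 2`, `c = 1/2` (the dyadic bookkeeping of `ReplicaOverlap.wallArmLowerRegularity_of_pow_extension`).

Nothing here asserts G; no Theses statement is touched; no definitions.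
-/

noncomputable section

open MeasureTheory Finset Filter
open Literature.Probability.Percolation Literature.Probability.LatticeModels
open Summit.CriticalPhenomena.PercolationContinuityZ3.Theorems.TallClusterMassBound.Negative
open Summit.CriticalPhenomena.PercolationContinuityZ3.Theorems.TallClusterMassBound.TightnessLine
open Summit.CriticalPhenomena.PercolationContinuityZ3.Theorems.FloorRusso.Reduce (clusterCapIn_mono_set clusterMaxIn_mono_set)

namespace Summit.CriticalPhenomena.PercolationContinuityZ3.Theorems.TallClusterMassBound.OnesidedHalves

/-! ## §1 Monotonicity of `M(Λ)` in the region `Λ` -/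

section Mono

variable {V : Type*}

/-- **`M(Λ) ≤ M(Λ')` for `Λ ⊆ Λ'`**, for every measure `μ` (Hutchcroft's typical maximum is monotone in the
region: `{|K_max(Λ)| ≥ n} ⊆ {|K_max(Λ')| ≥ n}`; an infinite `μ` has `M(Λ) = 0`). [folklore] -/
theorem typicalMax_mono_of_subset (μ : Measure (BondConfig V)) {Λ Λ' : Finset V} (h : Λ ⊆ Λ') :
    typicalMax μ Λ ≤ typicalMax μ Λ' := by
  by_cases hμ : μ Set.univ = ⊤
  · -- infinite measure: `μ.real univ = 0 ≤ e^{-1}`, so `M(Λ) = 0`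
    have h0 : typicalMax μ Λ ≤ 0 := by
      refine Nat.sInf_le ?_
      have huniv : {ω : BondConfig V | 0 ≤ clusterMaxIn Λ ω} = Set.univ :=
        Set.eq_univ_of_forall fun ω => Nat.zero_le _
      simp only [Set.mem_setOf_eq, huniv, measureReal_def, hμ, ENNReal.toReal_top]
      exact (Real.exp_pos _).le
    omega
  · refine Nat.sInf_le ?_
    have hfin : μ {ω | typicalMax μ Λ' ≤ clusterMaxIn Λ' ω} ≠ ⊤ :=
      ne_top_of_le_ne_top hμ (measure_mono (Set.subset_univ _))
    calc μ.real {ω | typicalMax μ Λ' ≤ clusterMaxIn Λ ω}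
        ≤ μ.real {ω | typicalMax μ Λ' ≤ clusterMaxIn Λ' ω} :=
          measureReal_mono (fun ω hω => le_trans hω (clusterMaxIn_mono_set h ω)) hfin
      _ ≤ Real.exp (-1) := real_typicalMax_le_clusterMaxIn_le μ Λ'

end Mono

/-- The half-boxes increase with the radius: `Λ_ρ ⊆ Λ_r` for `ρ ≤ r`. [folklore] -/
theorem halfBox_mono {ρ r : ℕ} (h : ρ ≤ r) : halfBox ρ ⊆ halfBox r := by
  intro x hx
  rw [halfBox, Finset.mem_filter] at hx ⊢
  exact ⟨box_mono 3 h hx.1, hx.2⟩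

/-- `M(Λ_ρ) ≤ M(Λ_r)` for `ρ ≤ r`, under any measure (in particular under `P^ℍ_{p_c}`). [folklore] -/
theorem typicalMax_halfBox_mono (μ : Measure (BondConfig V3)) {ρ r : ℕ} (h : ρ ≤ r) :
    typicalMax μ (halfBox ρ) ≤ typicalMax μ (halfBox r) :=
  typicalMax_mono_of_subset μ (halfBox_mono h)

/-! ## §2 The quantile unfolded -/

section Quantile

variable {V : Type*}

/-- **`n < M(Λ) ↔ e^{-1} < μ(|K_max(Λ)| ≥ n)`** for a finite measure (the tail `n ↦ μ(|K_max(Λ)| ≥ n)` is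
non-increasing, and `M(Λ)` is the least `n` at which it is `≤ e^{-1}`). [cite: Hutchcroft2021, §2.1 (p. 11)] -/
theorem lt_typicalMax_iff (μ : Measure (BondConfig V)) [IsFiniteMeasure μ] (Λ : Finset V) (n : ℕ) :
    n < typicalMax μ Λ ↔ Real.exp (-1) < μ.real {ω | n ≤ clusterMaxIn Λ ω} := by
  refine ⟨exp_neg_one_lt_real_of_lt_typicalMax μ Λ, fun h => ?_⟩
  by_contra hle
  push Not at hle
  have hmem := Nat.sInf_mem (typicalMax_set_nonempty μ Λ)
  simp only [Set.mem_setOf_eq] at hmem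
  have hmono : μ.real {ω | n ≤ clusterMaxIn Λ ω} ≤ μ.real {ω | typicalMax μ Λ ≤ clusterMaxIn Λ ω} :=
    measureReal_mono (fun ω hω => le_trans hle hω) (measure_ne_top _ _)
  have : μ.real {ω | typicalMax μ Λ ≤ clusterMaxIn Λ ω} ≤ Real.exp (-1) := hmem
  linarith

/-- For `m ≥ 1`: `m ≤ M(Λ) ↔ e^{-1} < μ(|K_max(Λ)| ≥ m - 1)` (finite `μ`). [folklore] -/
theorem le_typicalMax_iff_of_pos (μ : Measure (BondConfig V)) [IsFiniteMeasure μ] (Λ : Finset V) {m : ℕ}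
    (hm : 1 ≤ m) : m ≤ typicalMax μ Λ ↔ Real.exp (-1) < μ.real {ω | m - 1 ≤ clusterMaxIn Λ ω} := by
  rw [← lt_typicalMax_iff]
  omega

end Quantile

/-- **The merging estimate, probabilistic form.** For `r ≥ 1` (indeed for all `r`, as `M(Λ_r) ≥ 2`):
`2 M(Λ_r) ≤ M(Λ')` iff with `P^ℍ_{p_c}`-probability `> e^{-1}` some open cluster has at least `2 M(Λ_r) - 1`
vertices in `Λ'`. [folklore] -/
theorem two_mul_typicalMax_le_iff (r : ℕ) (Λ' : Finset V3) :
    2 * typicalMax (floorDilutedPercolation 3 (criticalProbI 3) 1) (halfBox r) ≤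
        typicalMax (floorDilutedPercolation 3 (criticalProbI 3) 1) Λ' ↔
      Real.exp (-1) < (floorDilutedPercolation 3 (criticalProbI 3) 1).real
        {ω | 2 * typicalMax (floorDilutedPercolation 3 (criticalProbI 3) 1) (halfBox r) - 1 ≤ clusterMaxIn Λ' ω} := by
  have h2 : 2 ≤ typicalMax (floorDilutedPercolation 3 (criticalProbI 3) 1) (halfBox r) :=
    two_le_typicalMax _ (halfBox_nonempty r)
  exact le_typicalMax_iff_of_pos _ Λ' (by omega)

/-! ## §3 The reshape: G ⟺ fixed-ratio doubling of the typical maximum -/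

/-- Iterating a fixed-ratio doubling: `2^j M(Λ_r) ≤ M(Λ_{L^j r})` for `r ≥ 1`. [folklore] -/
theorem typicalMax_pow_mul_ge (μ : Measure (BondConfig V3)) {L : ℕ} (hL : 1 ≤ L)
    (h : ∀ r : ℕ, 1 ≤ r → 2 * typicalMax μ (halfBox r) ≤ typicalMax μ (halfBox (L * r))) :
    ∀ j r : ℕ, 1 ≤ r → 2 ^ j * typicalMax μ (halfBox r) ≤ typicalMax μ (halfBox (L ^ j * r))
  | 0, r, _ => by simp
  | j + 1, r, hr => by
    have ih := typicalMax_pow_mul_ge μ hL h j r hr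
    have hle : 1 ≤ L ^ j * r := le_trans hr (Nat.le_mul_of_pos_left r (pow_pos hL j))
    calc 2 ^ (j + 1) * typicalMax μ (halfBox r) = 2 * (2 ^ j * typicalMax μ (halfBox r)) := by ring
      _ ≤ 2 * typicalMax μ (halfBox (L ^ j * r)) := Nat.mul_le_mul_left 2 ih
      _ ≤ typicalMax μ (halfBox (L * (L ^ j * r))) := h _ hle
      _ = typicalMax μ (halfBox (L ^ (j + 1) * r)) := by rw [pow_succ]; congr 2; ring

/-- **G ⟹ fixed-ratio doubling**: from `c (r/ρ)^κ M(Λ_ρ) ≤ M(Λ_r)` take `ρ = r`, `r ↦ L r` with `L` so large that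
`c L^κ > 2`. [folklore] -/
theorem fixedRatio_of_typicalMaxPolyGrowth
    (hG : ∃ c κ : ℝ, 0 < c ∧ 0 < κ ∧ ∀ ρ r : ℕ, 1 ≤ ρ → ρ ≤ r →
      c * ((r : ℝ) / ρ) ^ κ * (typicalMax (floorDilutedPercolation 3 (criticalProbI 3) 1) (halfBox ρ) : ℝ) ≤
        typicalMax (floorDilutedPercolation 3 (criticalProbI 3) 1) (halfBox r)) :
    ∃ L : ℕ, 2 ≤ L ∧ ∀ r : ℕ, 1 ≤ r →
      2 * typicalMax (floorDilutedPercolation 3 (criticalProbI 3) 1) (halfBox r) ≤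
        typicalMax (floorDilutedPercolation 3 (criticalProbI 3) 1) (halfBox (L * r)) := by
  obtain ⟨c, κ, hc, hκ, hG⟩ := hG
  set P := floorDilutedPercolation 3 (criticalProbI 3) 1 with hP
  obtain ⟨L, hL1, hL⟩ := exists_nat_lt_rpow (max (2 / c) 1) hκ
  have hL0 : (0 : ℝ) ≤ L := Nat.cast_nonneg _
  -- `L ≥ 2` since `L^κ > 1`
  have hL2 : 2 ≤ L := by
    by_contra hlt
    have hL1' : L = 1 := by omega
    have : (L : ℝ) ^ κ = 1 := by rw [hL1']; simp
    have := lt_of_le_of_lt (le_max_right (2 / c) 1) hL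
    linarith
  have hcL : 2 < c * (L : ℝ) ^ κ := by
    have := lt_of_le_of_lt (le_max_left (2 / c) 1) hL
    rw [div_lt_iff₀ hc] at this
    linarith
  refine ⟨L, hL2, fun r hr => ?_⟩
  have hr0 : (0 : ℝ) < r := by exact_mod_cast hr
  have hratio : ((L * r : ℕ) : ℝ) / r = L := by
    push_cast; field_simp
  have key := hG r (L * r) hr (Nat.le_mul_of_pos_left r (by omega))
  rw [hratio] at key
  have hM0 : (0 : ℝ) ≤ typicalMax P (halfBox r) := Nat.cast_nonneg _
  have hreal : (2 : ℝ) * typicalMax P (halfBox r) ≤ typicalMax P (halfBox (L * r)) :=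
    le_trans (mul_le_mul_of_nonneg_right hcL.le hM0) key
  exact_mod_cast hreal

/-- **Fixed-ratio doubling ⟹ G** with `c = 1/2`, `κ = log_L 2`: for `L^j ≤ r/ρ < L^{j+1}`,
`M(Λ_r) ≥ M(Λ_{L^j ρ}) ≥ 2^j M(Λ_ρ)` and `(1/2)(r/ρ)^κ ≤ (1/2)(L^{j+1})^κ = 2^j`. [folklore] -/
theorem typicalMaxPolyGrowth_of_fixedRatio {L : ℕ} (hL : 2 ≤ L)
    (h : ∀ r : ℕ, 1 ≤ r →
      2 * typicalMax (floorDilutedPercolation 3 (criticalProbI 3) 1) (halfBox r) ≤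
        typicalMax (floorDilutedPercolation 3 (criticalProbI 3) 1) (halfBox (L * r))) :
    ∀ ρ r : ℕ, 1 ≤ ρ → ρ ≤ r →
      (1 / 2 : ℝ) * ((r : ℝ) / ρ) ^ (Real.logb L 2) *
          (typicalMax (floorDilutedPercolation 3 (criticalProbI 3) 1) (halfBox ρ) : ℝ) ≤
        typicalMax (floorDilutedPercolation 3 (criticalProbI 3) 1) (halfBox r) := by
  set P := floorDilutedPercolation 3 (criticalProbI 3) 1 with hP
  set κ : ℝ := Real.logb L 2 with hκ
  have hL1 : 1 < L := by omega
  have hLR1 : (1 : ℝ) < L := by exact_mod_cast hL1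
  have hLpos : (0 : ℝ) < L := by positivity
  have hκ0 : 0 < κ := Real.logb_pos hLR1 (by norm_num)
  have hLκ : (L : ℝ) ^ κ = 2 := by rw [hκ, Real.rpow_logb hLpos hLR1.ne' (by norm_num)]
  intro ρ r hρ hρr
  have hρpos : 0 < ρ := hρ
  have hρ0 : (0 : ℝ) < ρ := by exact_mod_cast hρ
  set j : ℕ := Nat.log L (r / ρ) with hj
  have hq1 : 1 ≤ r / ρ := (Nat.le_div_iff_mul_le hρpos).2 (by simpa using hρr)
  have hj1 : L ^ j ≤ r / ρ := Nat.pow_log_le_self L (by omega)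
  have hj2 : r / ρ < L ^ (j + 1) := Nat.lt_pow_succ_log_self hL1 _
  have hr_ge : L ^ j * ρ ≤ r := by
    have := (Nat.le_div_iff_mul_le hρpos).1 hj1
    simpa [Nat.mul_comm] using this
  have hr_lt : r < L ^ (j + 1) * ρ := by
    have := (Nat.div_lt_iff_lt_mul hρpos).1 hj2
    linarith [Nat.mul_comm (L ^ (j + 1)) ρ]
  -- M(Λ_r) ≥ M(Λ_{L^j ρ}) ≥ 2^j M(Λ_ρ)
  have hchain : 2 ^ j * typicalMax P (halfBox ρ) ≤ typicalMax P (halfBox r) :=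
    le_trans (typicalMax_pow_mul_ge P (by omega) h j ρ hρ) (typicalMax_halfBox_mono P hr_ge)
  have hchainR : (2 : ℝ) ^ j * typicalMax P (halfBox ρ) ≤ typicalMax P (halfBox r) := by exact_mod_cast hchain
  -- (r/ρ)^κ ≤ (L^{j+1})^κ = 2^{j+1}
  have hratio_le : (r : ℝ) / ρ ≤ (L : ℝ) ^ (j + 1) := by
    rw [div_le_iff₀ hρ0]
    exact_mod_cast hr_lt.le
  have hpow : ((L : ℝ) ^ (j + 1)) ^ κ = (2 : ℝ) ^ (j + 1) := by
    rw [← hLκ, ← Real.rpow_natCast (L : ℝ) (j + 1), ← Real.rpow_mul hLpos.le, mul_comm,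
      Real.rpow_mul hLpos.le, Real.rpow_natCast]
  have hfac : ((r : ℝ) / ρ) ^ κ ≤ (2 : ℝ) ^ (j + 1) := by
    rw [← hpow]
    exact Real.rpow_le_rpow (by positivity) hratio_le hκ0.le
  have hM0 : (0 : ℝ) ≤ typicalMax P (halfBox ρ) := Nat.cast_nonneg _
  calc (1 / 2 : ℝ) * ((r : ℝ) / ρ) ^ κ * typicalMax P (halfBox ρ)
      ≤ (1 / 2 : ℝ) * (2 : ℝ) ^ (j + 1) * typicalMax P (halfBox ρ) :=
        mul_le_mul_of_nonneg_right (mul_le_mul_of_nonneg_left hfac (by norm_num)) hM0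
    _ = (2 : ℝ) ^ j * typicalMax P (halfBox ρ) := by rw [pow_succ]; ring
    _ ≤ typicalMax P (halfBox r) := hchainR

/-- **Stub G ⟺ fixed-ratio doubling of the typical maximum.** The registered stub `stub_typicalMaxPolyGrowth` of line
`onesided-halves` (`∃ c κ > 0, ∀ 1 ≤ ρ ≤ r, c (r/ρ)^κ M(Λ_ρ) ≤ M(Λ_r)` under `P^ℍ_{p_c}`) holds iff for SOME fixed
scale ratio `L ≥ 2` the typical maximum at least doubles: `∀ r ≥ 1, 2 M(Λ_r) ≤ M(Λ_{Lr})`. [folklore] -/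
theorem typicalMaxPolyGrowth_iff_fixedRatio :
    (∃ c κ : ℝ, 0 < c ∧ 0 < κ ∧ ∀ ρ r : ℕ, 1 ≤ ρ → ρ ≤ r →
      c * ((r : ℝ) / ρ) ^ κ * (typicalMax (floorDilutedPercolation 3 (criticalProbI 3) 1) (halfBox ρ) : ℝ) ≤
        typicalMax (floorDilutedPercolation 3 (criticalProbI 3) 1) (halfBox r)) ↔
    (∃ L : ℕ, 2 ≤ L ∧ ∀ r : ℕ, 1 ≤ r →
      2 * typicalMax (floorDilutedPercolation 3 (criticalProbI 3) 1) (halfBox r) ≤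
        typicalMax (floorDilutedPercolation 3 (criticalProbI 3) 1) (halfBox (L * r))) := by
  constructor
  · exact fixedRatio_of_typicalMaxPolyGrowth
  · rintro ⟨L, hL, h⟩
    have hLR1 : (1 : ℝ) < L := by exact_mod_cast (show 1 < L by omega)
    exact ⟨1 / 2, Real.logb L 2, by norm_num, Real.logb_pos hLR1 (by norm_num),
      typicalMaxPolyGrowth_of_fixedRatio hL h⟩

/-- **G ⟺ the merging estimate** (the exact missing engine of line `onesided-halves`, probabilistic form): stub G
holds iff for SOME fixed `L ≥ 2` and every `r ≥ 1`, with `P^ℍ_{p_c}`-probability `> e^{-1}` a single open cluster has at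
least `2 M(Λ_r) - 1` vertices in `Λ_{Lr}`. [folklore] -/
theorem typicalMaxPolyGrowth_iff_merging :
    (∃ c κ : ℝ, 0 < c ∧ 0 < κ ∧ ∀ ρ r : ℕ, 1 ≤ ρ → ρ ≤ r →
      c * ((r : ℝ) / ρ) ^ κ * (typicalMax (floorDilutedPercolation 3 (criticalProbI 3) 1) (halfBox ρ) : ℝ) ≤
        typicalMax (floorDilutedPercolation 3 (criticalProbI 3) 1) (halfBox r)) ↔
    (∃ L : ℕ, 2 ≤ L ∧ ∀ r : ℕ, 1 ≤ r →
      Real.exp (-1) < (floorDilutedPercolation 3 (criticalProbI 3) 1).real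
        {ω | 2 * typicalMax (floorDilutedPercolation 3 (criticalProbI 3) 1) (halfBox r) - 1 ≤
          clusterMaxIn (halfBox (L * r)) ω}) := by
  rw [typicalMaxPolyGrowth_iff_fixedRatio]
  refine exists_congr fun L => and_congr_right fun _ => forall_congr' fun r => imp_congr_right fun _ => ?_
  exact two_mul_typicalMax_le_iff r (halfBox (L * r))

end Summit.CriticalPhenomena.PercolationContinuityZ3.Theorems.TallClusterMassBound.OnesidedHalves

end
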